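import Mathlib
import Literature.Analysis.Toeplitz.OneSidedSeries

/-!
# Wall bubbling for `DoorA26` — (W) chain piece at a Weyl TRIPLE: THE CLASS TOWER LIMIT UNDER THE MOMENT TAIL (power-series form)

HONEST FRAMING.  Chain lemma toward `TripleStratum26` of `Cruxes/DoorA26/Lines/wall_bubbling_ConfluentDoor.lean` (rev 13; crux `DoorA26`,
stmt-ValiantsHypothesis-19979 — OPEN, typed, never asserted).  W1 seat val-sym-door-p2 g15 (#82); companion of #81 `…MomentTail` (independent imports).  W2's
`classTower_limit` (`…ClassTower`, door-p1 g13) proves the continuous convergence of the `ε^r`-weighted class functions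
`t ↦ μ_ν⁻¹ Σ_i a_i^ν (ε_i^ν)^r e^{ε_i^ν t}` of ONE merging value class from the convergence of the normalised moments `M_m^ν/μ_ν → c_m` (`m < n`)
and the crude tail `(Σ_i |a_i^ν|)·w_ν^n/μ_ν → 0`.  At a Weyl triple the crude tail is unavailable (sub-clustered members, blown-up coefficients);
this file re-proves the SAME conclusion from the MOMENT tail `|M_m^ν| ≤ τ_ν μ_ν` (`m ≥ n`, `τ_ν → 0`), which #81 `momentTail` supplies gap-free:

* `hasSum_momentSeries` — the class function IS its moment series: `Σ_i a_i ε_i^r e^{ε_i t} = Σ_{j≥0} M_{r+j} t^j/j!` (`HasSum`; finite sum of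
  exponential series, the tree's `Literature.Analysis.Toeplitz.hasSum_pow_div_factorial`);
* **`momentTower_limit`** — moments converge below `n`, moment tail `τ_ν → 0` above ⇒ for every weight `r`, along every subsequence and every
  convergent sequence of times in a window, `μ⁻¹ Σ_i a_i ε_i^r e^{ε_i t_k} → P^{(r)}(t₀) = Σ_{m<n−r} c_{r+m} t₀^m/m!` (head: termwise; tail: dominated by
  `τ·e^R` through `HasSum.norm_le_of_bounded`).  Same conclusion shape as `classTower_limit`, so the class assembly (#83) is shared.

No definitions; nothing here bears on `DoorA26`, `MatrixDescartes` (stmt-ValiantsHypothesis-18050) or `VP ≠ VNP`; `TripleStratum26`, (W), (M) OPEN.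

[folklore] Exponential series; dominated convergence of power series with bounded coefficients.
-/

-- `Summit.ValiantsHypothesis.ValiantsHypothesis.…` repeats a component by the D-0017 layout
-- (single-conjunct summit), which the `dupNamespace` linter flags; the name is mandated.
set_option linter.dupNamespace false

namespace Summit.ValiantsHypothesis.ValiantsHypothesis.Theorems.LacunarySymmetroidMatrixDescartes.WallBubbling

open Finset Filter Topology
open scoped BigOperators

/-! ## 1. The class function as its moment series -/

/-- **The `ε^r`-weighted class function is its moment series**: `Σ_i a_i ε_i^r e^{ε_i t} = Σ_j M_{r+j} t^j / j!`,
`M_m = Σ_i a_i ε_i^m`. [folklore] -/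
theorem hasSum_momentSeries {ι : Type*} [Fintype ι] (a ε : ι → ℝ) (r : ℕ) (t : ℝ) :
    HasSum (fun j : ℕ => (∑ i, a i * ε i ^ (r + j)) * t ^ j / (j.factorial : ℝ))
      (∑ i, a i * ε i ^ r * Real.exp (ε i * t)) := by
  have h : ∀ i ∈ (univ : Finset ι), HasSum (fun j : ℕ => a i * ε i ^ r * ((ε i * t) ^ j / (j.factorial : ℝ)))
      (a i * ε i ^ r * Real.exp (ε i * t)) := fun i _ => (Literature.Analysis.Toeplitz.hasSum_pow_div_factorial (ε i * t)).mul_left _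
  have heq : (fun j : ℕ => (∑ i, a i * ε i ^ (r + j)) * t ^ j / (j.factorial : ℝ))
      = fun j => ∑ i, a i * ε i ^ r * ((ε i * t) ^ j / (j.factorial : ℝ)) := by
    funext j
    rw [Finset.sum_mul, Finset.sum_div]
    refine Finset.sum_congr rfl fun i _ => ?_
    rw [mul_pow, pow_add]
    ring
  rw [heq]
  exact hasSum_sum h

/-! ## 2. The class tower limit under the moment tail -/

/-- **CLASS TOWER LIMIT UNDER THE MOMENT TAIL.**  See the module docstring. [folklore] -/
theorem momentTower_limit {ι : Type*} [Fintype ι] (n : ℕ) (a ε : ℕ → ι → ℝ) (μ τ : ℕ → ℝ) (c : ℕ → ℝ)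
    (hμ : ∀ ν, 0 < μ ν)
    (hmom : ∀ m < n, Tendsto (fun ν => (∑ i, a ν i * ε ν i ^ m) / μ ν) atTop (𝓝 (c m)))
    (htail : ∀ ν m, n ≤ m → |∑ i, a ν i * ε ν i ^ m| ≤ τ ν * μ ν) (hτ : Tendsto τ atTop (𝓝 0))
    (r : ℕ) (φ : ℕ → ℕ) (hφ : StrictMono φ) (R : ℝ) (t : ℕ → ℝ) (t₀ : ℝ) (htR : ∀ k, |t k| ≤ R)
    (htlim : Tendsto t atTop (𝓝 t₀)) :
    Tendsto (fun k => (∑ i, a (φ k) i * ε (φ k) i ^ r * Real.exp (ε (φ k) i * t k)) / μ (φ k)) atTop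
      (𝓝 (∑ m ∈ Finset.range (n - r), c (r + m) * t₀ ^ m / m.factorial)) := by
  set J : ℕ := n - r with hJ
  -- normalised shifted moments
  set u : ℕ → ℕ → ℝ := fun k j => (∑ i, a (φ k) i * ε (φ k) i ^ (r + j)) / μ (φ k) with hu
  set F : ℕ → ℝ := fun k => (∑ i, a (φ k) i * ε (φ k) i ^ r * Real.exp (ε (φ k) i * t k)) / μ (φ k) with hF
  -- the series for the normalised class function
  have hser : ∀ k, HasSum (fun j => u k j * t k ^ j / (j.factorial : ℝ)) (F k) := by
    intro k
    have h := (hasSum_momentSeries (a (φ k)) (ε (φ k)) r (t k)).div_const (μ (φ k))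
    have heq : (fun j : ℕ => (∑ i, a (φ k) i * ε (φ k) i ^ (r + j)) * t k ^ j / (j.factorial : ℝ) / μ (φ k))
        = fun j => u k j * t k ^ j / (j.factorial : ℝ) := by
      funext j; simp only [hu]; ring
    rw [heq] at h
    exact h
  -- τ ≥ 0
  have hτ0 : ∀ ν, 0 ≤ τ ν := by
    intro ν
    have h := htail ν n le_rfl
    have h' : 0 ≤ τ ν * μ ν := (abs_nonneg _).trans h
    exact nonneg_of_mul_nonneg_left h' (hμ ν)
  -- tail coefficients are `τ`-small
  have hutail : ∀ k j, |u k (j + J)| ≤ τ (φ k) := by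
    intro k j
    have hn : n ≤ r + (j + J) := by omega
    rw [hu]
    simp only
    rw [abs_div, abs_of_pos (hμ (φ k)), div_le_iff₀ (hμ (φ k))]
    exact htail (φ k) _ hn
  -- the tail of the series and its bound
  have htail_sum : ∀ k, HasSum (fun j => u k (j + J) * t k ^ (j + J) / ((j + J).factorial : ℝ))
      (F k - ∑ j ∈ Finset.range J, u k j * t k ^ j / (j.factorial : ℝ)) := by
    intro k
    exact (hasSum_nat_add_iff' J).mpr (hser k)
  have htail_bd : ∀ k, |F k - ∑ j ∈ Finset.range J, u k j * t k ^ j / (j.factorial : ℝ)| ≤ τ (φ k) * Real.exp R := by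
    intro k
    have hg : HasSum (fun j => τ (φ k) * (|t k| ^ (j + J) / ((j + J).factorial : ℝ)))
        (τ (φ k) * (Real.exp |t k| - ∑ i ∈ Finset.range J, |t k| ^ i / (i.factorial : ℝ))) :=
      ((hasSum_nat_add_iff' J).mpr (Literature.Analysis.Toeplitz.hasSum_pow_div_factorial |t k|)).mul_left _
    have hle : ∀ j, ‖u k (j + J) * t k ^ (j + J) / ((j + J).factorial : ℝ)‖ ≤ τ (φ k) * (|t k| ^ (j + J) / ((j + J).factorial : ℝ)) := by
      intro j
      rw [Real.norm_eq_abs, abs_div, abs_mul, abs_pow, Nat.abs_cast, mul_div_assoc]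
      exact mul_le_mul_of_nonneg_right (hutail k j) (by positivity)
    have h1 := HasSum.norm_le_of_bounded (htail_sum k) hg hle
    rw [Real.norm_eq_abs] at h1
    have hpart : 0 ≤ ∑ i ∈ Finset.range J, |t k| ^ i / (i.factorial : ℝ) := Finset.sum_nonneg fun i _ => by positivity
    calc |F k - ∑ j ∈ Finset.range J, u k j * t k ^ j / (j.factorial : ℝ)|
        ≤ τ (φ k) * (Real.exp |t k| - ∑ i ∈ Finset.range J, |t k| ^ i / (i.factorial : ℝ)) := h1
      _ ≤ τ (φ k) * Real.exp |t k| := by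
          apply mul_le_mul_of_nonneg_left _ (hτ0 _); linarith
      _ ≤ τ (φ k) * Real.exp R := by
          apply mul_le_mul_of_nonneg_left _ (hτ0 _); exact Real.exp_le_exp.mpr (htR k)
  -- the head converges termwise
  have hhead : Tendsto (fun k => ∑ j ∈ Finset.range J, u k j * t k ^ j / (j.factorial : ℝ)) atTop
      (𝓝 (∑ m ∈ Finset.range J, c (r + m) * t₀ ^ m / (m.factorial : ℝ))) := by
    refine tendsto_finsetSum _ fun j hj => ?_
    have hjn : r + j < n := by have := Finset.mem_range.mp hj; omega
    have h1 : Tendsto (fun k => u k j) atTop (𝓝 (c (r + j))) := (hmom (r + j) hjn).comp hφ.tendsto_atTop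
    exact ((h1.mul (htlim.pow j)).div_const _)
  -- the tail tends to zero
  have htail0 : Tendsto (fun k => F k - ∑ j ∈ Finset.range J, u k j * t k ^ j / (j.factorial : ℝ)) atTop (𝓝 0) := by
    have hτφ : Tendsto (fun k => τ (φ k) * Real.exp R) atTop (𝓝 0) := by
      have := (hτ.comp hφ.tendsto_atTop).mul_const (Real.exp R)
      simpa using this
    refine squeeze_zero_norm (fun k => ?_) hτφ
    rw [Real.norm_eq_abs]
    exact htail_bd k
  -- assemble
  have hsum : Tendsto (fun k => (∑ j ∈ Finset.range J, u k j * t k ^ j / (j.factorial : ℝ))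
      + (F k - ∑ j ∈ Finset.range J, u k j * t k ^ j / (j.factorial : ℝ))) atTop
      (𝓝 ((∑ m ∈ Finset.range J, c (r + m) * t₀ ^ m / (m.factorial : ℝ)) + 0)) := hhead.add htail0
  rw [add_zero] at hsum
  refine hsum.congr fun k => ?_
  ring

end Summit.ValiantsHypothesis.ValiantsHypothesis.Theorems.LacunarySymmetroidMatrixDescartes.WallBubbling
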